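import Literature.AlgebraicGeometry.HodgeTheory.WeilClassesFieldCentreInSubfield
import Literature.AlgebraicGeometry.HodgeTheory.WeilClassesFieldEvenRankOfNoTypeIVFactor
import HarnessLib

/-!
# `W_F` Hodge, `r` even and `[F:ℚ] ∣ dim A` WITHOUT a type hypothesis: for `F` totally real (Criterion (1) holds
# trivially, `σ′ = σ`), and for every `F` once `Z(End⁰ A) ⊆ F′` with `W_{F′}` Hodge (Remark (1)) — Moonen–Zarhin 1998, §1

Layer `Literature/AlgebraicGeometry/HodgeTheory`, theorem-only sequel (no definition, no named fact, no `sorry`) of the seat's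
`WeilClassesFieldEvenRankOfNoTypeIVFactor` (whose §1 gives, for BALANCED multiplicities `n_ρ = n_ρ̄`: `r` even and
`[F:ℚ] ∣ dim A`, and whose §2–§3 discharge the balance by «no factor of type IV») and `WeilClassesFieldCentreInSubfield`
(Remark (1) after Criterion (2) with «`F′ ⊇ E`» read in `End⁰(A)`): the same package of consequences in the two other
situations where the balance comes for free.

PRINTED STATEMENTS.  B. J. J. Moonen – Yu. G. Zarhin, *Weil classes on abelian varieties*, J. reine angew. Math. 496 (1998)
83–92 = arXiv:alg-geom/9612017 (held text `paper:arxiv-alg-geom_9612017`).  §1 (chunk p0001): «Write `Σ_F` for the set of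
embeddings `F → ℂ`, and for `σ ∈ Σ_F`, let `σ′` denote its complex conjugate. … we have `n_σ + n_σ′ = 2g/[F:ℚ]` for all
`σ ∈ Σ_F`»; Criterion: «If `n_σ = n_σ′` for all `σ ∈ Σ_F` then `W_F` consists entirely of Hodge classes» — for `F` TOTALLY
REAL `σ′ = σ`, so the hypothesis holds for every `X`; Criterion (2) (chunk p0003): «recall that this assumption implies that
`r = dim_F(V_X)` is even. Then either all classes in `W_F` are decomposable, or all non-zero classes in `W_F` are
exceptional»; Remark (1) after Criterion (2) (chunk p0004): «if `E ⊂ F′`, then `W_{F′}` consists of Hodge classes if and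
only if `Hdg` is semi-simple.  If this holds, then for any other subfield `F ⊆ End⁰(X)`, the space `W_F` also consists of
Hodge classes».

RENDERING.  `A` a complex abelian variety; `F = ℚ(φ)`, `P(φ) = 0`, `P ∈ ℤ[T]` monic irreducible of degree `e`,
`e · r = 2 dim A`; «`F` totally real» = every complex root of `P` is real; `n_ρ = eigenMultiplicity A φ ρ`;
`W_F ⊗ ℂ = weilClassesField A φ P r`; «Hodge» = `≤ hodgeClassSpan` / `IsOfHodgeType (r/2, r/2)`; «decomposable» =
`∈ divisorClassesSpan`; «`F′ ⊇ E`» = `Subalgebra.center ℚ A.endAlgebra ≤ Algebra.adjoin ℚ {endAlgebra.of A φ′}`;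
`G_div(X)(ℂ)` = `Milne1999.unitaryCentralizerGroup A h` (`h ∈ B¹ ⊗ ℂ`, `Q_h` non-degenerate).

WHAT IS PROVED.
* §0 (balanced multiplicities, any `A`; complements the sequel's §1) `weilClassesField_dichotomy_of_forall_eigenMultiplicity_eq`
  — `n_ρ = n_ρ̄` at the roots ⟹ all of `W_F ⊗ ℂ` is of type `(m, m)` and EITHER `W_F ⊗ ℂ ≤ Dᵐ ⊗ ℂ` OR every non-zero
  rational class is exceptional (`e · 2m = 2 dim A`, `m ≠ 0`);
  `exists_exceptional_iff_exists_detOnEigenspace_ne_one_of_forall_eigenMultiplicity_eq` — then `W_F` has an exceptional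
  rational Hodge class iff some `u ∈ S(A)(h)(ℂ)` has `det(u | V_ρ) ≠ 1` at some root.
* §1 (`F` TOTALLY REAL) `forall_eigenMultiplicity_eq_of_forall_root_im_eq_zero` — the balance is automatic (`ρ̄ = ρ`);
  **`weilClassesField_le_hodgeClassSpan_of_forall_root_im_eq_zero`** — `W_F ⊗ ℂ ≤ Bᵐ ⊗ ℂ`;
  `forall_isOfHodgeType_of_mem_weilClassesField_of_forall_root_im_eq_zero`; **`even_of_forall_root_im_eq_zero`** — `r` is
  even; **`natDegree_dvd_dim_of_forall_root_im_eq_zero`** — `[F:ℚ] ∣ dim A` for every totally real `F = ℚ(φ) ⊆ End⁰(A)`;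
  `two_mul_eigenMultiplicity_mul_natDegree_eq_of_forall_root_im_eq_zero` — `2 n_ρ · [F:ℚ] = 2 dim A` at every root;
  `weilClassesField_dichotomy_of_forall_root_im_eq_zero`; `hodgeGroupOne_le_weilSpecialUnitaryGroupCM_of_forall_root_im_eq_zero`.
* §2 (EVERY `F`, when `Z(End⁰ A) ⊆ ℚ[1 ⊗ φ′]` and `n_{ρ′} = n_{ρ̄′}` at the roots of `P′`)
  **`even_of_center_le_adjoin_endAlgebra`**, **`natDegree_dvd_dim_of_center_le_adjoin_endAlgebra`**,
  `weilClassesField_dichotomy_of_center_le_adjoin_endAlgebra`,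
  `exists_exceptional_iff_exists_detOnEigenspace_ne_one_of_center_le_adjoin_endAlgebra`,
  `forall_isOfHodgeType_of_mem_weilClassesField_of_center_le_adjoin_endAlgebra`,
  `hodgeGroupOne_le_weilSpecialUnitaryGroupCM_of_center_le_adjoin_endAlgebra`; and for `E = ℚ`
  (`Subalgebra.center ℚ A.endAlgebra ≤ ⊥`): `even_of_center_le_bot`, **`natDegree_dvd_dim_of_center_le_bot`** — every
  subfield `ℚ(φ)` of an `End⁰(A)` with centre `ℚ` has degree dividing `dim A`.

Honesty clause: consequences of the Criterion and of Remark (1) only; no Weil class is proved algebraic; «`F` totally real»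
and «`F′ ⊇ E`» are the renderings above; the type-by-type case list of Criterion (2) is not touched.
No `sorry`; axioms `propext`, `Classical.choice`, `Quot.sound`.

## References
* [MoonenZarhin1998WeilClasses] B. J. J. Moonen, Yu. G. Zarhin, *Weil classes on abelian varieties*, J. reine angew.
  Math. 496 (1998) 83–92 = arXiv:alg-geom/9612017, §1 (chunk p0001: `n_σ + n_σ′ = 2g/[F:ℚ]`, the Criterion), Criterion
  (2) first sentence (chunk p0003), Remark (1) after Criterion (2) (chunk p0004).
* [LangeBirkenhake1992] H. Lange, Ch. Birkenhake, *Complex Abelian Varieties*, §5.5 (Prop. 5.5.7) and §9.2 (real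
  multiplication: `[F:ℚ] ∣ dim`).
* [Milne1999LefschetzClasses] J. S. Milne, *Lefschetz classes on abelian varieties*, Duke Math. J. 96 (1999), Thm. 3.2,
  Thm. 4.4, Cor. 4.5.
* [vanGeemen1994HodgeAV] B. van Geemen, LNM 1594 (1994), §2.4.
-/

noncomputable section

open CategoryTheory Polynomial Module

namespace Literature.AlgebraicGeometry.HodgeTheory

open Literature.AlgebraicTopology.SingularHomology
open Literature.AlgebraicGeometry.Motives
open Literature.AlgebraicGeometry.VanGeemen1994 (hodgeClassSpan pullbackOne detOnEigenspace hodgeGroupOne)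
open Literature.AlgebraicGeometry.Milne1999 (unitaryCentralizerGroup)
open Literature.Barriers.HodgeConjecture (divisorClassesSpan)

section HodgeTheory

variable {A : AbelianVariety ℂ} {φ : A ⟶ A} {P : Polynomial ℤ} {e r m : ℕ} {h : complexBetti A.X 2}

/-! ### §0 Balanced multiplicities ⟹ the dichotomy (any `A`) -/

section Balanced

/-- **CRITERION (2), FIRST SENTENCE, FROM CRITERION (1)'s HYPOTHESIS: balanced multiplicities ⟹ all of `W_F ⊗ ℂ` is of type
`(m, m)` and either `W_F ⊗ ℂ ≤ Dᵐ ⊗ ℂ` or every non-zero rational class of it is exceptional** (`e · 2m = 2 dim A`, `m ≠ 0`;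
the tree's `isOfHodgeType_of_mem_weilClassesField_of_balanced` and `weilClassesField_le_divisorClassesSpan_or_forall_not_mem`).
[cite: MoonenZarhin1998WeilClasses, §1 Criterion (1) (chunk p0001) and Criterion (2), first sentence (chunk p0003); section «all or nothing»]
[cite: vanGeemen1994HodgeAV, §2.4] -/
theorem weilClassesField_dichotomy_of_forall_eigenMultiplicity_eq (hPm : P.Monic) (hPe : P.natDegree = e)
    (hPirr : Irreducible (P.map (Int.castRingHom ℚ)))
    (hφ : Polynomial.eval₂ (Int.castRingHom (CategoryTheory.End A)) (φ : CategoryTheory.End A) P = 0)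
    (her : e * (2 * m) = 2 * A.dim) (hm : m ≠ 0)
    (hbal : ∀ ρ : ℂ, Polynomial.eval₂ (Int.castRingHom ℂ) ρ P = 0 →
      eigenMultiplicity A φ ρ = eigenMultiplicity A φ (starRingEnd ℂ ρ)) :
    (∀ c ∈ weilClassesField A φ P (2 * m), IsOfHodgeType A.dim A.X (2 * m) m m c) ∧
      (weilClassesField A φ P (2 * m) ≤ divisorClassesSpan A.X A.dim m ∨
        ∀ c ∈ weilClassesField A φ P (2 * m), IsRationalClass c → c ≠ 0 → c ∉ divisorClassesSpan A.X A.dim m) := by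
  refine ⟨fun c hc => ?_, weilClassesField_le_divisorClassesSpan_or_forall_not_mem hPe hPirr hφ her hm⟩
  have h := isOfHodgeType_of_mem_weilClassesField_of_balanced hPm hPe hPirr hφ her hbal hc
  rwa [Nat.mul_div_cancel_left m two_pos] at h

/-- **… and then `W_F` has an EXCEPTIONAL rational Hodge class iff some `u ∈ S(A)(h)(ℂ)` has `det(u | V_ρ) ≠ 1` at some root**
(`h ∈ B¹ ⊗ ℂ` with `Q_h` non-degenerate; the seat's `weilClassesField_inf_divisorClassesSpan_eq_bot_iff_exists_detOnEigenspace_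
ne_one` and the all-or-nothing lemma). [cite: MoonenZarhin1998WeilClasses, §1 Criterion (2) and its proof (chunk p0003)]
[cite: Milne1999LefschetzClasses, Thm. 3.2, Thm. 4.4, Cor. 4.5] -/
theorem exists_exceptional_iff_exists_detOnEigenspace_ne_one_of_forall_eigenMultiplicity_eq (hPm : P.Monic)
    (hPe : P.natDegree = e) (hPirr : Irreducible (P.map (Int.castRingHom ℚ)))
    (hφ : Polynomial.eval₂ (Int.castRingHom (CategoryTheory.End A)) (φ : CategoryTheory.End A) P = 0)
    (her : e * (2 * m) = 2 * A.dim) (hm : m ≠ 0)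
    (hbal : ∀ ρ : ℂ, Polynomial.eval₂ (Int.castRingHom ℂ) ρ P = 0 →
      eigenMultiplicity A φ ρ = eigenMultiplicity A φ (starRingEnd ℂ ρ))
    (hh : h ∈ hodgeClassSpan A.dim A.X 1)
    (hnd : ∀ x : complexBetti A.X 1, (∀ y, polarizationPairingOne A.X h (A.dim - 1) x y = 0) → x = 0) :
    (∃ γ ∈ weilClassesField A φ P (2 * m), IsRationalClass γ ∧ IsOfHodgeType A.dim A.X (2 * m) m m γ ∧
        γ ∉ divisorClassesSpan A.X A.dim m) ↔
      ∃ (u : complexBetti A.X 1 ≃ₗ[ℂ] complexBetti A.X 1) (hu : u ∈ unitaryCentralizerGroup A h) (ρ : ℂ),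
        Polynomial.eval₂ (Int.castRingHom ℂ) ρ P = 0 ∧ detOnEigenspace u (pullbackOne A φ) (hu.1 φ) ρ ≠ 1 := by
  rw [← weilClassesField_inf_divisorClassesSpan_eq_bot_iff_exists_detOnEigenspace_ne_one hPm hPe hPirr hφ her hm hh hnd]
  refine ⟨fun ⟨γ, hγW, _, _, hγD⟩ => ?_, fun hbot => ?_⟩
  · rcases weilClassesField_inf_divisorClassesSpan_eq_bot_or_le hPe hPirr hφ her hm with hbot | hle
    · exact hbot
    · exact absurd (hle hγW) hγD
  · obtain ⟨γ, hγW, hγQ, hγH, hγ0⟩ :=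
      (exists_isRationalClass_isOfHodgeType_ne_zero_iff_balanced hPm hPe hPirr hφ her (by omega)).2 hbal
    rw [Nat.mul_div_cancel_left m two_pos] at hγH
    refine ⟨γ, hγW, hγQ, hγH, fun hγD => hγ0 ?_⟩
    have hγ : γ ∈ weilClassesField A φ P (2 * m) ⊓ divisorClassesSpan A.X A.dim m := ⟨hγW, hγD⟩
    rwa [hbot, Submodule.mem_bot] at hγ

end Balanced

/-! ### §1 `F` totally real: the balance is automatic -/

section TotallyReal

/-- **FOR `F` TOTALLY REAL, `n_σ = n_σ′` HOLDS TRIVIALLY (`σ′ = σ`)**: if every complex root of `P` is real then `n_ρ = n_ρ̄` at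
every root. [cite: MoonenZarhin1998WeilClasses, §1 («let σ′ denote its complex conjugate»; chunk p0001) and the Criterion] -/
theorem forall_eigenMultiplicity_eq_of_forall_root_im_eq_zero
    (hreal : ∀ ρ : ℂ, Polynomial.eval₂ (Int.castRingHom ℂ) ρ P = 0 → ρ.im = 0) :
    ∀ ρ : ℂ, Polynomial.eval₂ (Int.castRingHom ℂ) ρ P = 0 →
      eigenMultiplicity A φ ρ = eigenMultiplicity A φ (starRingEnd ℂ ρ) :=
  fun ρ hρ => by rw [Complex.conj_eq_iff_im.2 (hreal ρ hρ)]

/-- **`W_F` CONSISTS OF HODGE CLASSES FOR EVERY TOTALLY REAL `F = ℚ(φ) ⊆ End⁰(A)`** (`P` monic irreducible of degree `e` with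
only real roots, `P(φ) = 0`, `e · 2m = 2 dim A`): `W_F ⊗ ℂ ≤ Bᵐ ⊗ ℂ` (Criterion (1), the tree's
`Deligne1982.weilClassesField_le_hodgeClassSpan_iff_forall_eigenMultiplicity_eq`).
[cite: MoonenZarhin1998WeilClasses, §1 Criterion (chunk p0001)] -/
theorem weilClassesField_le_hodgeClassSpan_of_forall_root_im_eq_zero (hPm : P.Monic) (hPe : P.natDegree = e)
    (hPirr : Irreducible (P.map (Int.castRingHom ℚ)))
    (hφ : Polynomial.eval₂ (Int.castRingHom (CategoryTheory.End A)) (φ : CategoryTheory.End A) P = 0)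
    (her : e * (2 * m) = 2 * A.dim) (hreal : ∀ ρ : ℂ, Polynomial.eval₂ (Int.castRingHom ℂ) ρ P = 0 → ρ.im = 0) :
    weilClassesField A φ P (2 * m) ≤ hodgeClassSpan A.dim A.X m :=
  (Deligne1982.weilClassesField_le_hodgeClassSpan_iff_forall_eigenMultiplicity_eq hPm hPe hPirr hφ her).2
    (forall_eigenMultiplicity_eq_of_forall_root_im_eq_zero hreal)

/-- **… class by class: every class of `W_F ⊗ ℂ ⊆ Hʳ` is of type `(r/2, r/2)` for totally real `F`** (`e · r = 2 dim A`).
[cite: MoonenZarhin1998WeilClasses, §1 Criterion (chunk p0001)] -/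
theorem forall_isOfHodgeType_of_mem_weilClassesField_of_forall_root_im_eq_zero (hPm : P.Monic) (hPe : P.natDegree = e)
    (hPirr : Irreducible (P.map (Int.castRingHom ℚ)))
    (hφ : Polynomial.eval₂ (Int.castRingHom (CategoryTheory.End A)) (φ : CategoryTheory.End A) P = 0)
    (her : e * r = 2 * A.dim) (hreal : ∀ ρ : ℂ, Polynomial.eval₂ (Int.castRingHom ℂ) ρ P = 0 → ρ.im = 0) :
    ∀ c ∈ weilClassesField A φ P r, IsOfHodgeType A.dim A.X r (r / 2) (r / 2) c :=
  fun _ hc => isOfHodgeType_of_mem_weilClassesField_of_balanced hPm hPe hPirr hφ her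
    (forall_eigenMultiplicity_eq_of_forall_root_im_eq_zero hreal) hc

/-- **FOR TOTALLY REAL `F`, `r = 2 dim A/[F:ℚ]` IS EVEN** (`n_ρ + n_ρ̄ = r` with `ρ̄ = ρ`).
[cite: MoonenZarhin1998WeilClasses, §1 «n_σ + n_σ′ = 2g/[F:ℚ]» (chunk p0001) and Criterion (2), first sentence (chunk p0003)] -/
theorem even_of_forall_root_im_eq_zero (hPm : P.Monic) (hPe : P.natDegree = e)
    (hPirr : Irreducible (P.map (Int.castRingHom ℚ)))
    (hφ : Polynomial.eval₂ (Int.castRingHom (CategoryTheory.End A)) (φ : CategoryTheory.End A) P = 0)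
    (her : e * r = 2 * A.dim) (hreal : ∀ ρ : ℂ, Polynomial.eval₂ (Int.castRingHom ℂ) ρ P = 0 → ρ.im = 0) : Even r :=
  even_of_forall_eigenMultiplicity_eq hPm hPe hPirr hφ her (forall_eigenMultiplicity_eq_of_forall_root_im_eq_zero hreal)

/-- **A TOTALLY REAL FIELD OF ENDOMORPHISMS HAS DEGREE DIVIDING `dim A`**: for `φ ∈ End(A)` with `P(φ) = 0`, `P ∈ ℤ[T]` monic
irreducible with only real roots, `deg P ∣ dim A` (as for real multiplication, Lange–Birkenhake §9.2).
[cite: MoonenZarhin1998WeilClasses, §1 «n_σ + n_σ′ = 2g/[F:ℚ]» (chunk p0001) and Criterion (2), first sentence (chunk p0003)]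
[cite: LangeBirkenhake1992, §9.2 and §5.5 Prop. 5.5.7] -/
theorem natDegree_dvd_dim_of_forall_root_im_eq_zero (hPm : P.Monic) (hPirr : Irreducible (P.map (Int.castRingHom ℚ)))
    (hφ : Polynomial.eval₂ (Int.castRingHom (CategoryTheory.End A)) (φ : CategoryTheory.End A) P = 0)
    (hreal : ∀ ρ : ℂ, Polynomial.eval₂ (Int.castRingHom ℂ) ρ P = 0 → ρ.im = 0) : P.natDegree ∣ A.dim := by
  obtain ⟨r, hr⟩ := natDegree_dvd_two_mul_dim (A := A) hPm hPirr hφ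
  exact natDegree_dvd_dim_of_forall_eigenMultiplicity_eq hPm rfl hPirr hφ hr.symm
    (forall_eigenMultiplicity_eq_of_forall_root_im_eq_zero hreal)

/-- **… indeed every real root `ρ` has `2 n_ρ · [F:ℚ] = 2 dim A`** (`n_ρ + n_ρ̄ = dim V_ρ` with `ρ̄ = ρ`, and
`dim V_ρ · deg P = 2 dim A`). [cite: MoonenZarhin1998WeilClasses, §1 «n_σ + n_σ′ = 2g/[F:ℚ]» (chunk p0001)] -/
theorem two_mul_eigenMultiplicity_mul_natDegree_eq_of_forall_root_im_eq_zero (hPm : P.Monic)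
    (hPirr : Irreducible (P.map (Int.castRingHom ℚ)))
    (hφ : Polynomial.eval₂ (Int.castRingHom (CategoryTheory.End A)) (φ : CategoryTheory.End A) P = 0)
    (hreal : ∀ ρ : ℂ, Polynomial.eval₂ (Int.castRingHom ℂ) ρ P = 0 → ρ.im = 0) {ρ : ℂ}
    (hρ : Polynomial.eval₂ (Int.castRingHom ℂ) ρ P = 0) :
    2 * eigenMultiplicity A φ ρ * P.natDegree = 2 * A.dim := by
  obtain ⟨r, hr⟩ := natDegree_dvd_two_mul_dim (A := A) hPm hPirr hφ
  have hsum := eigenMultiplicity_add_eigenMultiplicity_conj_eq hPm rfl hPirr hφ hr.symm hρ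
  rw [Complex.conj_eq_iff_im.2 (hreal ρ hρ), ← two_mul] at hsum
  rw [hsum, mul_comm, hr]

/-- **For totally real `F`: Criterion (2)'s dichotomy** (`e · 2m = 2 dim A`, `m ≠ 0`): all of `W_F ⊗ ℂ` is of type `(m, m)`,
and either `W_F ⊗ ℂ ≤ Dᵐ ⊗ ℂ` or every non-zero rational class of it is exceptional.
[cite: MoonenZarhin1998WeilClasses, §1 Criterion (2), first sentence (chunk p0003)] [cite: vanGeemen1994HodgeAV, §2.4] -/
theorem weilClassesField_dichotomy_of_forall_root_im_eq_zero (hPm : P.Monic) (hPe : P.natDegree = e)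
    (hPirr : Irreducible (P.map (Int.castRingHom ℚ)))
    (hφ : Polynomial.eval₂ (Int.castRingHom (CategoryTheory.End A)) (φ : CategoryTheory.End A) P = 0)
    (her : e * (2 * m) = 2 * A.dim) (hm : m ≠ 0) (hreal : ∀ ρ : ℂ, Polynomial.eval₂ (Int.castRingHom ℂ) ρ P = 0 → ρ.im = 0) :
    (∀ c ∈ weilClassesField A φ P (2 * m), IsOfHodgeType A.dim A.X (2 * m) m m c) ∧
      (weilClassesField A φ P (2 * m) ≤ divisorClassesSpan A.X A.dim m ∨
        ∀ c ∈ weilClassesField A φ P (2 * m), IsRationalClass c → c ≠ 0 → c ∉ divisorClassesSpan A.X A.dim m) :=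
  weilClassesField_dichotomy_of_forall_eigenMultiplicity_eq hPm hPe hPirr hφ her hm
    (forall_eigenMultiplicity_eq_of_forall_root_im_eq_zero hreal)

/-- **For totally real `F`: `Hg|_{H¹} ≤ SU(φ)(ℂ)`** for every `h ∈ B¹ ⊗ ℂ` (`e · 2m = 2 dim A`; the tree's
`Deligne1982.hodgeGroupOne_le_weilSpecialUnitaryGroupCM_of_forall_eigenMultiplicity_eq`).
[cite: MoonenZarhin1998WeilClasses, §1 second Remark after the Criterion («contained in Sl_F(V_X)») and the Criterion] -/
theorem hodgeGroupOne_le_weilSpecialUnitaryGroupCM_of_forall_root_im_eq_zero (hPm : P.Monic) (hPe : P.natDegree = e)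
    (hPirr : Irreducible (P.map (Int.castRingHom ℚ)))
    (hφ : Polynomial.eval₂ (Int.castRingHom (CategoryTheory.End A)) (φ : CategoryTheory.End A) P = 0)
    (her : e * (2 * m) = 2 * A.dim) (hreal : ∀ ρ : ℂ, Polynomial.eval₂ (Int.castRingHom ℂ) ρ P = 0 → ρ.im = 0)
    (hh : h ∈ hodgeClassSpan A.dim A.X 1) :
    hodgeGroupOne A.dim A.X ≤ Deligne1982.weilSpecialUnitaryGroupCM A φ P h :=
  Deligne1982.hodgeGroupOne_le_weilSpecialUnitaryGroupCM_of_forall_eigenMultiplicity_eq hPm hPe hPirr hφ her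
    (forall_eigenMultiplicity_eq_of_forall_root_im_eq_zero hreal) hh

end TotallyReal

/-! ### §2 Every `F`, when `Z(End⁰ A) ⊆ F′` and `W_{F′}` is Hodge -/

section CentreInSubfield

variable {φ' : A ⟶ A} {P' : Polynomial ℤ}

/-- **UNDER «`F′ ⊇ E`, `W_{F′}` Hodge», `r` IS EVEN FOR EVERY `F = ℚ(φ)`** (`Z(End⁰ A) ⊆ ℚ[1 ⊗ φ′]`, `P′(φ′) = 0` with `P′`
irreducible, `n_{ρ′} = n_{ρ̄′}` at the roots of `P′`; `P` monic irreducible of degree `e`, `P(φ) = 0`, `e · r = 2 dim A`): the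
seat's `eigenMultiplicity_eq_of_center_le_adjoin_endAlgebra` gives the balance for `φ`.
[cite: MoonenZarhin1998WeilClasses, §1 Remark (1) after Criterion (2) (chunk p0004) and Criterion (2), first sentence (chunk p0003)] -/
theorem even_of_center_le_adjoin_endAlgebra
    (hZ : Subalgebra.center ℚ A.endAlgebra ≤ Algebra.adjoin ℚ {AbelianVariety.endAlgebra.of A φ'})
    (hP'irr : Irreducible (P'.map (Int.castRingHom ℚ)))
    (hφ' : Polynomial.eval₂ (Int.castRingHom (CategoryTheory.End A)) (φ' : CategoryTheory.End A) P' = 0)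
    (hbal' : ∀ ρ' : ℂ, Polynomial.eval₂ (Int.castRingHom ℂ) ρ' P' = 0 →
      eigenMultiplicity A φ' ρ' = eigenMultiplicity A φ' (starRingEnd ℂ ρ'))
    (hPm : P.Monic) (hPe : P.natDegree = e) (hPirr : Irreducible (P.map (Int.castRingHom ℚ)))
    (hφ : Polynomial.eval₂ (Int.castRingHom (CategoryTheory.End A)) (φ : CategoryTheory.End A) P = 0)
    (her : e * r = 2 * A.dim) : Even r :=
  even_of_forall_eigenMultiplicity_eq hPm hPe hPirr hφ her
    fun ρ _ => eigenMultiplicity_eq_of_center_le_adjoin_endAlgebra hZ hP'irr hφ' hbal' hPirr hφ ρ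

/-- **… so `[F:ℚ] ∣ dim A` for EVERY subfield `F = ℚ(φ) ⊆ End⁰(A)`** under «`F′ ⊇ E`, `W_{F′}` Hodge».
[cite: MoonenZarhin1998WeilClasses, §1 Remark (1) after Criterion (2) (chunk p0004) and Criterion (2), first sentence (chunk p0003)] -/
theorem natDegree_dvd_dim_of_center_le_adjoin_endAlgebra
    (hZ : Subalgebra.center ℚ A.endAlgebra ≤ Algebra.adjoin ℚ {AbelianVariety.endAlgebra.of A φ'})
    (hP'irr : Irreducible (P'.map (Int.castRingHom ℚ)))
    (hφ' : Polynomial.eval₂ (Int.castRingHom (CategoryTheory.End A)) (φ' : CategoryTheory.End A) P' = 0)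
    (hbal' : ∀ ρ' : ℂ, Polynomial.eval₂ (Int.castRingHom ℂ) ρ' P' = 0 →
      eigenMultiplicity A φ' ρ' = eigenMultiplicity A φ' (starRingEnd ℂ ρ'))
    (hPm : P.Monic) (hPirr : Irreducible (P.map (Int.castRingHom ℚ)))
    (hφ : Polynomial.eval₂ (Int.castRingHom (CategoryTheory.End A)) (φ : CategoryTheory.End A) P = 0) :
    P.natDegree ∣ A.dim := by
  obtain ⟨r, hr⟩ := natDegree_dvd_two_mul_dim (A := A) hPm hPirr hφ
  exact natDegree_dvd_dim_of_forall_eigenMultiplicity_eq hPm rfl hPirr hφ hr.symm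
    fun ρ _ => eigenMultiplicity_eq_of_center_le_adjoin_endAlgebra hZ hP'irr hφ' hbal' hPirr hφ ρ

/-- **… class by class: every class of every `W_F ⊗ ℂ ⊆ Hʳ` is of type `(r/2, r/2)`** («for any other subfield `F ⊆ End⁰(X)`,
the space `W_F` also consists of Hodge classes»; `e · r = 2 dim A`).
[cite: MoonenZarhin1998WeilClasses, §1 Remark (1) after Criterion (2) (chunk p0004)] -/
theorem forall_isOfHodgeType_of_mem_weilClassesField_of_center_le_adjoin_endAlgebra
    (hZ : Subalgebra.center ℚ A.endAlgebra ≤ Algebra.adjoin ℚ {AbelianVariety.endAlgebra.of A φ'})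
    (hP'irr : Irreducible (P'.map (Int.castRingHom ℚ)))
    (hφ' : Polynomial.eval₂ (Int.castRingHom (CategoryTheory.End A)) (φ' : CategoryTheory.End A) P' = 0)
    (hbal' : ∀ ρ' : ℂ, Polynomial.eval₂ (Int.castRingHom ℂ) ρ' P' = 0 →
      eigenMultiplicity A φ' ρ' = eigenMultiplicity A φ' (starRingEnd ℂ ρ'))
    (hPm : P.Monic) (hPe : P.natDegree = e) (hPirr : Irreducible (P.map (Int.castRingHom ℚ)))
    (hφ : Polynomial.eval₂ (Int.castRingHom (CategoryTheory.End A)) (φ : CategoryTheory.End A) P = 0)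
    (her : e * r = 2 * A.dim) :
    ∀ c ∈ weilClassesField A φ P r, IsOfHodgeType A.dim A.X r (r / 2) (r / 2) c :=
  forall_isOfHodgeType_of_mem_weilClassesField_of_center_le_adjoin hP'irr hφ'
    (pullbackOne_mem_adjoin_of_center_le_adjoin hZ) hbal' hPm hPe hPirr hφ her

/-- **… Criterion (2)'s dichotomy for every `F`** (`e · 2m = 2 dim A`, `m ≠ 0`).
[cite: MoonenZarhin1998WeilClasses, §1 Remark (1) after Criterion (2) (chunk p0004) and Criterion (2), first sentence (chunk p0003)]
[cite: vanGeemen1994HodgeAV, §2.4] -/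
theorem weilClassesField_dichotomy_of_center_le_adjoin_endAlgebra
    (hZ : Subalgebra.center ℚ A.endAlgebra ≤ Algebra.adjoin ℚ {AbelianVariety.endAlgebra.of A φ'})
    (hP'irr : Irreducible (P'.map (Int.castRingHom ℚ)))
    (hφ' : Polynomial.eval₂ (Int.castRingHom (CategoryTheory.End A)) (φ' : CategoryTheory.End A) P' = 0)
    (hbal' : ∀ ρ' : ℂ, Polynomial.eval₂ (Int.castRingHom ℂ) ρ' P' = 0 →
      eigenMultiplicity A φ' ρ' = eigenMultiplicity A φ' (starRingEnd ℂ ρ'))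
    (hPm : P.Monic) (hPe : P.natDegree = e) (hPirr : Irreducible (P.map (Int.castRingHom ℚ)))
    (hφ : Polynomial.eval₂ (Int.castRingHom (CategoryTheory.End A)) (φ : CategoryTheory.End A) P = 0)
    (her : e * (2 * m) = 2 * A.dim) (hm : m ≠ 0) :
    (∀ c ∈ weilClassesField A φ P (2 * m), IsOfHodgeType A.dim A.X (2 * m) m m c) ∧
      (weilClassesField A φ P (2 * m) ≤ divisorClassesSpan A.X A.dim m ∨
        ∀ c ∈ weilClassesField A φ P (2 * m), IsRationalClass c → c ≠ 0 → c ∉ divisorClassesSpan A.X A.dim m) :=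
  weilClassesField_dichotomy_of_forall_eigenMultiplicity_eq hPm hPe hPirr hφ her hm
    fun ρ _ => eigenMultiplicity_eq_of_center_le_adjoin_endAlgebra hZ hP'irr hφ' hbal' hPirr hφ ρ

/-- **… and, for every `F`: `W_F` has an exceptional rational Hodge class iff some `u ∈ S(A)(h)(ℂ)` has `det(u | V_ρ) ≠ 1`
at some root** (`h ∈ B¹ ⊗ ℂ` with `Q_h` non-degenerate; `e · 2m = 2 dim A`, `m ≠ 0`).
[cite: MoonenZarhin1998WeilClasses, §1 Remark (1) after Criterion (2) (chunk p0004) and Criterion (2) with its proof (chunk p0003)]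
[cite: Milne1999LefschetzClasses, Thm. 3.2, Thm. 4.4, Cor. 4.5] -/
theorem exists_exceptional_iff_exists_detOnEigenspace_ne_one_of_center_le_adjoin_endAlgebra
    (hZ : Subalgebra.center ℚ A.endAlgebra ≤ Algebra.adjoin ℚ {AbelianVariety.endAlgebra.of A φ'})
    (hP'irr : Irreducible (P'.map (Int.castRingHom ℚ)))
    (hφ' : Polynomial.eval₂ (Int.castRingHom (CategoryTheory.End A)) (φ' : CategoryTheory.End A) P' = 0)
    (hbal' : ∀ ρ' : ℂ, Polynomial.eval₂ (Int.castRingHom ℂ) ρ' P' = 0 →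
      eigenMultiplicity A φ' ρ' = eigenMultiplicity A φ' (starRingEnd ℂ ρ'))
    (hPm : P.Monic) (hPe : P.natDegree = e) (hPirr : Irreducible (P.map (Int.castRingHom ℚ)))
    (hφ : Polynomial.eval₂ (Int.castRingHom (CategoryTheory.End A)) (φ : CategoryTheory.End A) P = 0)
    (her : e * (2 * m) = 2 * A.dim) (hm : m ≠ 0) (hh : h ∈ hodgeClassSpan A.dim A.X 1)
    (hnd : ∀ x : complexBetti A.X 1, (∀ y, polarizationPairingOne A.X h (A.dim - 1) x y = 0) → x = 0) :
    (∃ γ ∈ weilClassesField A φ P (2 * m), IsRationalClass γ ∧ IsOfHodgeType A.dim A.X (2 * m) m m γ ∧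
        γ ∉ divisorClassesSpan A.X A.dim m) ↔
      ∃ (u : complexBetti A.X 1 ≃ₗ[ℂ] complexBetti A.X 1) (hu : u ∈ unitaryCentralizerGroup A h) (ρ : ℂ),
        Polynomial.eval₂ (Int.castRingHom ℂ) ρ P = 0 ∧ detOnEigenspace u (pullbackOne A φ) (hu.1 φ) ρ ≠ 1 :=
  exists_exceptional_iff_exists_detOnEigenspace_ne_one_of_forall_eigenMultiplicity_eq hPm hPe hPirr hφ her hm
    (fun ρ _ => eigenMultiplicity_eq_of_center_le_adjoin_endAlgebra hZ hP'irr hφ' hbal' hPirr hφ ρ) hh hnd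

/-- **… and `Hg|_{H¹} ≤ SU(φ)(ℂ)` for every `F = ℚ(φ)` and every `h ∈ B¹ ⊗ ℂ`** (`e · 2m = 2 dim A`).
[cite: MoonenZarhin1998WeilClasses, §1 Remark (1) after Criterion (2) (chunk p0004) and the second Remark («contained in Sl_F(V_X)»)] -/
theorem hodgeGroupOne_le_weilSpecialUnitaryGroupCM_of_center_le_adjoin_endAlgebra
    (hZ : Subalgebra.center ℚ A.endAlgebra ≤ Algebra.adjoin ℚ {AbelianVariety.endAlgebra.of A φ'})
    (hP'irr : Irreducible (P'.map (Int.castRingHom ℚ)))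
    (hφ' : Polynomial.eval₂ (Int.castRingHom (CategoryTheory.End A)) (φ' : CategoryTheory.End A) P' = 0)
    (hbal' : ∀ ρ' : ℂ, Polynomial.eval₂ (Int.castRingHom ℂ) ρ' P' = 0 →
      eigenMultiplicity A φ' ρ' = eigenMultiplicity A φ' (starRingEnd ℂ ρ'))
    (hPm : P.Monic) (hPe : P.natDegree = e) (hPirr : Irreducible (P.map (Int.castRingHom ℚ)))
    (hφ : Polynomial.eval₂ (Int.castRingHom (CategoryTheory.End A)) (φ : CategoryTheory.End A) P = 0)
    (her : e * (2 * m) = 2 * A.dim) (hh : h ∈ hodgeClassSpan A.dim A.X 1) :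
    hodgeGroupOne A.dim A.X ≤ Deligne1982.weilSpecialUnitaryGroupCM A φ P h :=
  hodgeGroupOne_le_weilSpecialUnitaryGroupCM_of_center_le_adjoin hP'irr hφ' (pullbackOne_mem_adjoin_of_center_le_adjoin hZ)
    hbal' hPm hPe hPirr hφ her hh

/-- **`E = ℚ` ⟹ `r` is even for every `F`** (`Z(End⁰ A) = ℚ · 1`; the seat's `eigenMultiplicity_eq_of_center_le_bot`).
[cite: MoonenZarhin1998WeilClasses, §1 Remark (1) after Criterion (2) (chunk p0004) and Criterion (2), first sentence (chunk p0003)] -/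
theorem even_of_center_le_bot (hZ : Subalgebra.center ℚ A.endAlgebra ≤ ⊥) (hPm : P.Monic) (hPe : P.natDegree = e)
    (hPirr : Irreducible (P.map (Int.castRingHom ℚ)))
    (hφ : Polynomial.eval₂ (Int.castRingHom (CategoryTheory.End A)) (φ : CategoryTheory.End A) P = 0)
    (her : e * r = 2 * A.dim) : Even r :=
  even_of_forall_eigenMultiplicity_eq hPm hPe hPirr hφ her fun ρ _ => eigenMultiplicity_eq_of_center_le_bot hZ hPirr hφ ρ

/-- **`E = ℚ` ⟹ EVERY SUBFIELD `ℚ(φ) ⊆ End⁰(A)` HAS DEGREE DIVIDING `dim A`** (e.g. `End⁰(A)` a central simple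
`ℚ`-algebra: types I–III with centre `ℚ`). [cite: MoonenZarhin1998WeilClasses, §1 Remark (1) after Criterion (2) (chunk p0004)
and Criterion (2), first sentence (chunk p0003)] [cite: LangeBirkenhake1992, §5.5 Prop. 5.5.7] -/
theorem natDegree_dvd_dim_of_center_le_bot (hZ : Subalgebra.center ℚ A.endAlgebra ≤ ⊥) (hPm : P.Monic)
    (hPirr : Irreducible (P.map (Int.castRingHom ℚ)))
    (hφ : Polynomial.eval₂ (Int.castRingHom (CategoryTheory.End A)) (φ : CategoryTheory.End A) P = 0) :
    P.natDegree ∣ A.dim := by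
  obtain ⟨r, hr⟩ := natDegree_dvd_two_mul_dim (A := A) hPm hPirr hφ
  exact natDegree_dvd_dim_of_forall_eigenMultiplicity_eq hPm rfl hPirr hφ hr.symm
    fun ρ _ => eigenMultiplicity_eq_of_center_le_bot hZ hPirr hφ ρ

end CentreInSubfield

end HodgeTheory

end Literature.AlgebraicGeometry.HodgeTheory

end
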